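import Summits.CriticalPhenomena.SAWScalingLimit.Theorems.SAWTotalPositivityBoundaryTP2Defs
import Summits.CriticalPhenomena.SAWScalingLimit.Theorems.SAWTotalPositivityBoundaryTP2Kernel
import Summits.CriticalPhenomena.SAWScalingLimit.Theorems.SAWTotalPositivityBoundaryTP2Symmetry
import Summits.CriticalPhenomena.SAWScalingLimit.Theorems.SAWTotalPositivityBoundaryTP2LadderKernelsInterior
import Summits.CriticalPhenomena.SAWScalingLimit.Theorems.EdgeOfPositivity.Negative.EdgeOfPositivityRectDomain
import HarnessLib

/-!
# Crux `BoundaryTP2` (stmt-CriticalPhenomena-7115), line `Sketch`: two top sites of a ladder between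
two bottom sites, crossing pairing vs nested pairing

Tool stub `stub_ladder_bbtt_nested3` of the line's skeleton: on the ladder
`R_L = discreteDomainGraph (rectDomain L 1) 1` (sites `{0..L} × {0,1}`), for the boundary quadruple
`(c₁,0), (c₂,0)` on the bottom row and `(d₁,1), (d₂,1)` on the top row with
`c₁ < d₂ < d₁ < c₂ ≤ L` (cyclic order `(c₁,0),(c₂,0),(d₁,1),(d₂,1)`; both top sites between the
two bottom sites) and `0 ≤ x ≤ 1/2`, the crossing pairing weighs at most the nested one:

  `Z((c₁,0),(d₁,1)) Z((c₂,0),(d₂,1)) ≤ Z((c₁,0),(d₂,1)) Z((c₂,0),(d₁,1))`.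

Proof. By `stub_ladderKernels_interior` (and `pathKernel_comm` for the two kernels whose bottom
site is the right endpoint) all four kernels are opposite-row kernels in the rank-two form
`Z = x^{n+1}/2 · (a_i b_j P^n - a'_i b'_j M^n)`, `n + 1 = j - i` for left column `i` and right
column `j`, `P = 1+x`, `M = 1-x`, `a_i = P + E_i`, `a'_i = M - E_i`, `b_j = P + E_{L-j}`,
`b'_j = M - E_{L-j}`, `E_k = Σ_{d<k} x^{2d+3}` (`ladderN3_kernel_cross`, `ladderN3_kernel_cross'`).
Since `E_k (1-x²) ≤ x³`, `0 ≤ E_k ≤ 1/6` on `[0, 1/2]`, so `a', b', M ≥ 0`, `a' P ≤ a M`,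
`b' P ≤ b M`, `M^n ≤ P^n`: an opposite-row bracket `D = a b P^n - a' b' M^n` satisfies
`D ≤ a b P^n` and `4x · a b P^n ≤ D P²`. Bounding the two crossing kernels above and the two
nested kernels below, with `u+1 = d₂-c₁`, `m+1 = d₁-d₂`, `w+1 = c₂-d₁` the claim reduces to
`x^{2m+2} P^{2m+6} b_{d₁} a_{d₂} ≤ 16 x² b_{d₂} a_{d₁}`, which follows from `a_{d₂} ≤ a_{d₁}`,
`b_{d₁} ≤ b_{d₂}` (`E_k` is monotone in `k`) and the scalar bound `(xP)^{2m} P^6 ≤ 729/64 ≤ 16`.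
-/

noncomputable section

namespace Summit.CriticalPhenomena.SAWScalingLimit.Theorems.BoundaryTP2

open Literature.Probability.LatticeModels Literature.Probability.RandomPlanarGeometry
open Summit.CriticalPhenomena.SAWScalingLimit.Theorems.EdgeOfPositivity.Negative
open scoped ENNReal

/-! ## The excursion sums `E_k = Σ_{d<k} x^{2d+3}` -/

-- adapted from `…BoundaryTP2LadderBbttAdjacent` (`ladderBbtt_E_*`)

/-- `E_k ≥ 0` for `x ≥ 0`. [folklore] -/
private theorem ladderN3_E_nonneg {x : ℝ} (hx : 0 ≤ x) (k : ℕ) :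
    0 ≤ ∑ d ∈ Finset.range k, x ^ (2 * d + 3) :=
  Finset.sum_nonneg fun _ _ => pow_nonneg hx _

/-- Telescoping: `E_k (1 - x²) + x^{2k+3} = x³`. [folklore] -/
private theorem ladderN3_E_telescope (x : ℝ) (k : ℕ) :
    (∑ d ∈ Finset.range k, x ^ (2 * d + 3)) * (1 - x ^ 2) + x ^ (2 * k + 3) = x ^ 3 := by
  induction k with
  | zero => simp
  | succ k ih =>
    rw [Finset.sum_range_succ]
    linear_combination ih

/-- Powers of `x ∈ [0, 1/2]` are at most the powers of `1/2`. [folklore] -/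
private theorem ladderN3_pow_le {x : ℝ} (hx0 : 0 ≤ x) (hx : x ≤ 1 / 2) (n : ℕ) :
    x ^ n ≤ (1 / 2) ^ n :=
  pow_le_pow_left₀ hx0 hx n

/-- `E_k ≤ 1/6` for `0 ≤ x ≤ 1/2` (from `E_k (1 - x²) ≤ x³ ≤ 1/8` and `1 - x² ≥ 3/4`).
[folklore] -/
private theorem ladderN3_E_le {x : ℝ} (hx0 : 0 ≤ x) (hx : x ≤ 1 / 2) (k : ℕ) :
    ∑ d ∈ Finset.range k, x ^ (2 * d + 3) ≤ 1 / 6 := by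
  have h := ladderN3_E_telescope x k
  have hE := ladderN3_E_nonneg hx0 k
  have hk : 0 ≤ x ^ (2 * k + 3) := pow_nonneg hx0 _
  have hx2 := ladderN3_pow_le hx0 hx 2
  have hx3 := ladderN3_pow_le hx0 hx 3
  norm_num at hx2 hx3
  nlinarith [mul_nonneg hE (by linarith : (0 : ℝ) ≤ 1 / 4 - x ^ 2)]

/-- `E_k` is monotone in `k` for `x ≥ 0`. [folklore] -/
private theorem ladderN3_E_mono {x : ℝ} (hx : 0 ≤ x) {k l : ℕ} (hkl : k ≤ l) :
    ∑ d ∈ Finset.range k, x ^ (2 * d + 3) ≤ ∑ d ∈ Finset.range l, x ^ (2 * d + 3) :=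
  Finset.sum_le_sum_of_subset_of_nonneg (Finset.range_mono hkl) fun _ _ _ => pow_nonneg hx _

/-! ## The rank-two form of the opposite-row ladder kernels -/

/-- Opposite-row kernels of the ladder `{0..L}×{0,1}` from a bottom site to a top site on its
right, in rank-two form: for `i + n + 1 = j ≤ L` and `x ≥ 0`,
`Z_{R_L}((i,0),(j,1)) = x^{n+1}/2 · (a_i b_j (1+x)^n - a'_i b'_j (1-x)^n)` with `a_i = 1+x+E_i`,
`a'_i = 1-x-E_i`, `b_j = 1+x+E_{L-j}`, `b'_j = 1-x-E_{L-j}` (a regrouping of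
`stub_ladderKernels_interior`). [folklore] -/
private theorem ladderN3_kernel_cross (L i j n : ℕ) (hn : i + n + 1 = j) (hjL : j ≤ L) {x : ℝ}
    (hx : 0 ≤ x) :
    pathKernel (discreteDomainGraph (rectDomain L 1) 1) x (st i 0) (st j 1) =
      ENNReal.ofReal (x ^ (n + 1) / 2 *
        ((1 + x + ∑ d ∈ Finset.range i, x ^ (2 * d + 3)) *
              (1 + x + ∑ d ∈ Finset.range (L - j), x ^ (2 * d + 3)) * (1 + x) ^ n -
          (1 - x - ∑ d ∈ Finset.range i, x ^ (2 * d + 3)) *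
              (1 - x - ∑ d ∈ Finset.range (L - j), x ^ (2 * d + 3)) * (1 - x) ^ n)) := by
  -- adapted from `ladderBbtt_kernel_cross` in `…BoundaryTP2LadderBbttAdjacent`
  rw [stub_ladderKernels_interior L i j (by omega) hjL hx 0 1 (Or.inl rfl) (Or.inr rfl),
    if_neg (by norm_num)]
  congr 1
  subst hn
  have e1 : i + n + 1 - i = n + 1 := by omega
  have e2 : n + 1 - 1 = n := rfl
  rw [e1, e2]
  ring

/-- Opposite-row kernels of the ladder `{0..L}×{0,1}` from a bottom site to a top site on its
left, in rank-two form: for `i + n + 1 = j ≤ L` and `x ≥ 0`,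
`Z_{R_L}((j,0),(i,1)) = x^{n+1}/2 · (a_i b_j (1+x)^n - a'_i b'_j (1-x)^n)` (same notation; by
`pathKernel_comm` this is `Z_{R_L}((i,1),(j,0))`, and the formula of `stub_ladderKernels_interior`
depends on the rows only through `r ≠ s`). [folklore] -/
private theorem ladderN3_kernel_cross' (L i j n : ℕ) (hn : i + n + 1 = j) (hjL : j ≤ L) {x : ℝ}
    (hx : 0 ≤ x) :
    pathKernel (discreteDomainGraph (rectDomain L 1) 1) x (st j 0) (st i 1) =
      ENNReal.ofReal (x ^ (n + 1) / 2 *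
        ((1 + x + ∑ d ∈ Finset.range i, x ^ (2 * d + 3)) *
              (1 + x + ∑ d ∈ Finset.range (L - j), x ^ (2 * d + 3)) * (1 + x) ^ n -
          (1 - x - ∑ d ∈ Finset.range i, x ^ (2 * d + 3)) *
              (1 - x - ∑ d ∈ Finset.range (L - j), x ^ (2 * d + 3)) * (1 - x) ^ n)) := by
  rw [pathKernel_comm (discreteDomainGraph (rectDomain L 1) 1) x (st j 0) (st i 1),
    stub_ladderKernels_interior L i j (by omega) hjL hx 1 0 (Or.inr rfl) (Or.inl rfl),
    if_neg (by norm_num)]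
  congr 1
  subst hn
  have e1 : i + n + 1 - i = n + 1 := by omega
  have e2 : n + 1 - 1 = n := rfl
  rw [e1, e2]
  ring

/-! ## Real inequalities in the rank-two variables -/

-- adapted from `…BoundaryTP2LadderBbttAdjacent` and `…BoundaryTP2LadderBbbtAdjacent`

/-- The correction part is at most the main part: `a' b' (1-x)^k ≤ a b (1+x)^k` (`a' ≤ a`,
`0 ≤ b' ≤ b`, `0 ≤ 1-x ≤ 1+x`). [folklore] -/
private theorem ladderN3_sub_le_main {x e f : ℝ} (k : ℕ) (hx0 : 0 ≤ x) (hx : x ≤ 1 / 2)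
    (he0 : 0 ≤ e) (hf0 : 0 ≤ f) (hf : f ≤ 1 / 6) :
    (1 - x - e) * (1 - x - f) * (1 - x) ^ k ≤ (1 + x + e) * (1 + x + f) * (1 + x) ^ k :=
  mul_le_mul (mul_le_mul (by linarith) (by linarith) (by linarith) (by linarith))
    (pow_le_pow_left₀ (by linarith) (by linarith) k) (pow_nonneg (by linarith) k)
    (mul_nonneg (by linarith) (by linarith))

/-- An opposite-row bracket is nonnegative: `0 ≤ a b (1+x)^k - a' b' (1-x)^k`. [folklore] -/
private theorem ladderN3_diff_nonneg {x e f : ℝ} (k : ℕ) (hx0 : 0 ≤ x) (hx : x ≤ 1 / 2)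
    (he0 : 0 ≤ e) (hf0 : 0 ≤ f) (hf : f ≤ 1 / 6) :
    0 ≤ (1 + x + e) * (1 + x + f) * (1 + x) ^ k - (1 - x - e) * (1 - x - f) * (1 - x) ^ k :=
  sub_nonneg.2 (ladderN3_sub_le_main k hx0 hx he0 hf0 hf)

/-- The rank-two form of an opposite-row kernel is nonnegative. [folklore] -/
private theorem ladderN3_cross_nonneg {x e f : ℝ} (k : ℕ) (hx0 : 0 ≤ x) (hx : x ≤ 1 / 2)
    (he0 : 0 ≤ e) (hf0 : 0 ≤ f) (hf : f ≤ 1 / 6) :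
    0 ≤ x ^ (k + 1) / 2 *
      ((1 + x + e) * (1 + x + f) * (1 + x) ^ k - (1 - x - e) * (1 - x - f) * (1 - x) ^ k) :=
  mul_nonneg (by positivity) (ladderN3_diff_nonneg k hx0 hx he0 hf0 hf)

/-- An opposite-row kernel is at most its main part (`a', b', 1-x ≥ 0` for `x ≤ 1/2`,
`e, f ≤ 1/6`). [folklore] -/
private theorem ladderN3_cross_upper {x e f : ℝ} (k : ℕ) (hx0 : 0 ≤ x) (hx : x ≤ 1 / 2)
    (he : e ≤ 1 / 6) (hf : f ≤ 1 / 6) :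
    x ^ (k + 1) / 2 *
        ((1 + x + e) * (1 + x + f) * (1 + x) ^ k - (1 - x - e) * (1 - x - f) * (1 - x) ^ k) ≤
      x ^ (k + 1) / 2 * ((1 + x + e) * (1 + x + f) * (1 + x) ^ k) :=
  mul_le_mul_of_nonneg_left
    (sub_le_self _ (mul_nonneg (mul_nonneg (by linarith) (by linarith)) (pow_nonneg (by linarith) k)))
    (by positivity)

/-- Lower bound of an opposite-row bracket: `4x · a b P^k ≤ (a b P^k - a' b' M^k) P²`, i.e.
`a' b' M^k P² ≤ a b P^k M²` (from `a' P ≤ a M`, `b' P ≤ b M`, `M^k ≤ P^k`) together with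
`P² - M² = 4x`. [folklore] -/
private theorem ladderN3_diff_lower {x e f : ℝ} (k : ℕ) (hx0 : 0 ≤ x) (hx : x ≤ 1 / 2)
    (he0 : 0 ≤ e) (hf0 : 0 ≤ f) (hf : f ≤ 1 / 6) :
    4 * x * ((1 + x + e) * (1 + x + f) * (1 + x) ^ k) ≤
      ((1 + x + e) * (1 + x + f) * (1 + x) ^ k - (1 - x - e) * (1 - x - f) * (1 - x) ^ k) *
        (1 + x) ^ 2 := by
  -- adapted from `ladderBbbt_diff_lower` in `…BoundaryTP2LadderBbbtAdjacent`
  have h1 : (1 - x - e) * (1 + x) ≤ (1 + x + e) * (1 - x) := by nlinarith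
  have h2 : (1 - x - f) * (1 + x) ≤ (1 + x + f) * (1 - x) := by nlinarith
  have h3 : (1 - x) ^ k ≤ (1 + x) ^ k := pow_le_pow_left₀ (by linarith) (by linarith) k
  have key : (1 - x - e) * (1 + x) * ((1 - x - f) * (1 + x)) * (1 - x) ^ k ≤
      (1 + x + e) * (1 - x) * ((1 + x + f) * (1 - x)) * (1 + x) ^ k :=
    mul_le_mul (mul_le_mul h1 h2 (mul_nonneg (by linarith) (by linarith))
      (mul_nonneg (by linarith) (by linarith))) h3 (pow_nonneg (by linarith) k)
      (mul_nonneg (mul_nonneg (by linarith) (by linarith)) (mul_nonneg (by linarith) (by linarith)))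
  nlinarith [key]

/-- The scalar inequality `x^{2m+2} (1+x)^{2m+6} ≤ 16 x²` on `[0, 1/2]`
(`(x(1+x))^{2m} ≤ 1` as `x(1+x) ≤ 3/4`, and `(1+x)^6 ≤ (3/2)^6 = 729/64 ≤ 16`). [folklore] -/
private theorem ladderN3_scalar {x : ℝ} (m : ℕ) (hx0 : 0 ≤ x) (hx : x ≤ 1 / 2) :
    x ^ (2 * m + 2) * (1 + x) ^ (2 * m + 6) ≤ 16 * x ^ 2 := by
  have h0 : 0 ≤ x * (1 + x) := mul_nonneg hx0 (by linarith)
  have h1 : x * (1 + x) ≤ 1 := by nlinarith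
  have hpow : x ^ (2 * m) * (1 + x) ^ (2 * m) ≤ 1 := by
    rw [← mul_pow]
    exact pow_le_one₀ h0 h1
  have hP6 : (1 + x) ^ 6 ≤ (3 / 2) ^ 6 := pow_le_pow_left₀ (by linarith) (by linarith) 6
  have hx2 : 0 ≤ x ^ 2 := sq_nonneg x
  calc x ^ (2 * m + 2) * (1 + x) ^ (2 * m + 6)
      = x ^ 2 * (x ^ (2 * m) * (1 + x) ^ (2 * m) * (1 + x) ^ 6) := by ring
    _ ≤ x ^ 2 * (1 * (3 / 2) ^ 6) :=
        mul_le_mul_of_nonneg_left (mul_le_mul hpow hP6 (by positivity) (by norm_num)) hx2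
    _ ≤ 16 * x ^ 2 := by norm_num; linarith

/-- The real inequality behind `stub_ladder_bbtt_nested3`, in the rank-two variables
`e₁ = E_{c₁}`, `a₂ = E_{d₂}`, `a₁ = E_{d₁}`, `b₁ = E_{L-d₁}`, `b₂ = E_{L-d₂}`, `f₂ = E_{L-c₂}`,
spans `d₂ - c₁ = u+1`, `d₁ - d₂ = m+1`, `c₂ - d₁ = w+1` (so `d₁ - c₁ = u+m+2`,
`c₂ - d₂ = m+w+2`). [folklore] -/
private theorem ladderN3_real {x e₁ a₂ a₁ b₁ b₂ f₂ : ℝ} (u m w : ℕ) (hx0 : 0 ≤ x)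
    (hx : x ≤ 1 / 2) (he₁ : 0 ≤ e₁) (he₁' : e₁ ≤ 1 / 6) (ha₂ : 0 ≤ a₂) (ha₂' : a₂ ≤ 1 / 6)
    (ha₁ : 0 ≤ a₁) (hb₁ : 0 ≤ b₁) (hb₁' : b₁ ≤ 1 / 6) (hb₂ : 0 ≤ b₂) (hb₂' : b₂ ≤ 1 / 6)
    (hf₂ : 0 ≤ f₂) (hf₂' : f₂ ≤ 1 / 6) (ha : a₂ ≤ a₁) (hb : b₁ ≤ b₂) :
    x ^ (u + m + 1 + 1) / 2 *
          ((1 + x + e₁) * (1 + x + b₁) * (1 + x) ^ (u + m + 1) -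
            (1 - x - e₁) * (1 - x - b₁) * (1 - x) ^ (u + m + 1)) *
        (x ^ (m + w + 1 + 1) / 2 *
          ((1 + x + a₂) * (1 + x + f₂) * (1 + x) ^ (m + w + 1) -
            (1 - x - a₂) * (1 - x - f₂) * (1 - x) ^ (m + w + 1))) ≤
      x ^ (u + 1) / 2 *
          ((1 + x + e₁) * (1 + x + b₂) * (1 + x) ^ u -
            (1 - x - e₁) * (1 - x - b₂) * (1 - x) ^ u) *
        (x ^ (w + 1) / 2 *
          ((1 + x + a₁) * (1 + x + f₂) * (1 + x) ^ w -
            (1 - x - a₁) * (1 - x - f₂) * (1 - x) ^ w)) := by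
  have hP4 : 0 < (1 + x) ^ 4 := by positivity
  -- the two crossing kernels from above, the two nested kernels from below
  have U11 := ladderN3_cross_upper (u + m + 1) hx0 hx he₁' hb₁'
  have U22 := ladderN3_cross_upper (m + w + 1) hx0 hx ha₂' hf₂'
  have N22 := ladderN3_cross_nonneg (m + w + 1) hx0 hx ha₂ hf₂ hf₂'
  have L12 := ladderN3_diff_lower u hx0 hx he₁ hb₂ hb₂'
  have L21 := ladderN3_diff_lower w hx0 hx ha₁ hf₂ hf₂'
  have D12 := ladderN3_diff_nonneg u hx0 hx he₁ hb₂ hb₂'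
  have A21 : 0 ≤ 4 * x * ((1 + x + a₁) * (1 + x + f₂) * (1 + x) ^ w) := by positivity
  -- the key comparison of the middle factors
  have hab : (1 + x + b₁) * (1 + x + a₂) ≤ (1 + x + b₂) * (1 + x + a₁) :=
    mul_le_mul (by linarith) (by linarith) (by positivity) (by positivity)
  have key : x ^ (2 * m + 2) * (1 + x) ^ (2 * m + 6) * ((1 + x + b₁) * (1 + x + a₂)) ≤
      16 * x ^ 2 * ((1 + x + b₂) * (1 + x + a₁)) :=
    mul_le_mul (ladderN3_scalar m hx0 hx) hab (by positivity) (by positivity)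
  refine le_of_mul_le_mul_right ?_ hP4
  calc x ^ (u + m + 1 + 1) / 2 *
          ((1 + x + e₁) * (1 + x + b₁) * (1 + x) ^ (u + m + 1) -
            (1 - x - e₁) * (1 - x - b₁) * (1 - x) ^ (u + m + 1)) *
        (x ^ (m + w + 1 + 1) / 2 *
          ((1 + x + a₂) * (1 + x + f₂) * (1 + x) ^ (m + w + 1) -
            (1 - x - a₂) * (1 - x - f₂) * (1 - x) ^ (m + w + 1))) * (1 + x) ^ 4
      ≤ x ^ (u + m + 1 + 1) / 2 * ((1 + x + e₁) * (1 + x + b₁) * (1 + x) ^ (u + m + 1)) *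
          (x ^ (m + w + 1 + 1) / 2 * ((1 + x + a₂) * (1 + x + f₂) * (1 + x) ^ (m + w + 1))) *
          (1 + x) ^ 4 :=
        mul_le_mul_of_nonneg_right (mul_le_mul U11 U22 N22 (by positivity)) (by positivity)
    _ = x ^ (u + 1) * x ^ (w + 1) / 4 * ((1 + x + e₁) * (1 + x + f₂)) *
          ((1 + x) ^ u * (1 + x) ^ w) *
          (x ^ (2 * m + 2) * (1 + x) ^ (2 * m + 6) * ((1 + x + b₁) * (1 + x + a₂))) := by ring
    _ ≤ x ^ (u + 1) * x ^ (w + 1) / 4 * ((1 + x + e₁) * (1 + x + f₂)) *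
          ((1 + x) ^ u * (1 + x) ^ w) * (16 * x ^ 2 * ((1 + x + b₂) * (1 + x + a₁))) :=
        mul_le_mul_of_nonneg_left key (by positivity)
    _ = x ^ (u + 1) / 2 * (4 * x * ((1 + x + e₁) * (1 + x + b₂) * (1 + x) ^ u)) *
          (x ^ (w + 1) / 2 * (4 * x * ((1 + x + a₁) * (1 + x + f₂) * (1 + x) ^ w))) := by ring
    _ ≤ x ^ (u + 1) / 2 *
            (((1 + x + e₁) * (1 + x + b₂) * (1 + x) ^ u -
                (1 - x - e₁) * (1 - x - b₂) * (1 - x) ^ u) * (1 + x) ^ 2) *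
          (x ^ (w + 1) / 2 *
            (((1 + x + a₁) * (1 + x + f₂) * (1 + x) ^ w -
                (1 - x - a₁) * (1 - x - f₂) * (1 - x) ^ w) * (1 + x) ^ 2)) :=
        mul_le_mul (mul_le_mul_of_nonneg_left L12 (by positivity))
          (mul_le_mul_of_nonneg_left L21 (by positivity)) (mul_nonneg (by positivity) A21)
          (mul_nonneg (by positivity) (mul_nonneg D12 (by positivity)))
    _ = x ^ (u + 1) / 2 *
          ((1 + x + e₁) * (1 + x + b₂) * (1 + x) ^ u -
            (1 - x - e₁) * (1 - x - b₂) * (1 - x) ^ u) *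
        (x ^ (w + 1) / 2 *
          ((1 + x + a₁) * (1 + x + f₂) * (1 + x) ^ w -
            (1 - x - a₁) * (1 - x - f₂) * (1 - x) ^ w)) * (1 + x) ^ 4 := by ring

/-! ## The stub -/

/-- **Tool stub `stub_ladder_bbtt_nested3`.** On the ladder `{0..L}×{0,1}`, for two bottom sites
`(c₁,0), (c₂,0)` and two top sites `(d₂,1), (d₁,1)` between them (`c₁ < d₂ < d₁ < c₂ ≤ L`,
cyclic order `(c₁,0),(c₂,0),(d₁,1),(d₂,1)`) and `0 ≤ x ≤ 1/2`: the crossing pairing weighs at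
most the NESTED one, `Z((c₁,0),(d₁,1)) Z((c₂,0),(d₂,1)) ≤ Z((c₁,0),(d₂,1)) Z((c₂,0),(d₁,1))`.
Mechanism: in the rank-two form of the ladder kernels (`ladderN3_kernel_cross`,
`ladderN3_kernel_cross'`) every kernel here joins opposite rows; the crossing kernels are at most
their main parts `x^{n+1}/2 · a b P^n`, the nested ones at least `4x/P²` times their main parts,
the crossing product of main parts carries the extra factor `(xP)^{2(d₁-d₂)}`, and
`(xP)^{2m} x² P² · P⁴ ≤ 16 x²` on `[0, 1/2]`; the end corrections `E_k` only help (`E` is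
monotone in `k`). [folklore] -/
theorem stub_ladder_bbtt_nested3 (L : ℕ) {c₁ c₂ d₂ d₁ : ℕ} (h₁ : c₁ < d₂) (h₂ : d₂ < d₁) (h₃ : d₁ < c₂)
    (h₄ : c₂ ≤ L) {x : ℝ} (hx0 : 0 ≤ x) (hx : x ≤ 1 / 2) :
    pathKernel (discreteDomainGraph (rectDomain L 1) 1) x (st c₁ 0) (st d₁ 1) *
        pathKernel (discreteDomainGraph (rectDomain L 1) 1) x (st c₂ 0) (st d₂ 1) ≤
      pathKernel (discreteDomainGraph (rectDomain L 1) 1) x (st c₁ 0) (st d₂ 1) *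
        pathKernel (discreteDomainGraph (rectDomain L 1) 1) x (st c₂ 0) (st d₁ 1) := by
  obtain ⟨u, hu⟩ : ∃ u, d₂ = c₁ + u + 1 := ⟨d₂ - c₁ - 1, by omega⟩
  obtain ⟨m, hm⟩ : ∃ m, d₁ = d₂ + m + 1 := ⟨d₁ - d₂ - 1, by omega⟩
  obtain ⟨w, hw⟩ : ∃ w, c₂ = d₁ + w + 1 := ⟨c₂ - d₁ - 1, by omega⟩
  have hE := fun k => ladderN3_E_nonneg hx0 k
  have hE' := fun k => ladderN3_E_le hx0 hx k
  rw [ladderN3_kernel_cross L c₁ d₁ (u + m + 1) (by omega) (by omega) hx0,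
    ladderN3_kernel_cross' L d₂ c₂ (m + w + 1) (by omega) h₄ hx0,
    ladderN3_kernel_cross L c₁ d₂ u (by omega) (by omega) hx0,
    ladderN3_kernel_cross' L d₁ c₂ w (by omega) h₄ hx0,
    ← ENNReal.ofReal_mul
      (ladderN3_cross_nonneg (u + m + 1) hx0 hx (hE c₁) (hE (L - d₁)) (hE' (L - d₁))),
    ← ENNReal.ofReal_mul (ladderN3_cross_nonneg u hx0 hx (hE c₁) (hE (L - d₂)) (hE' (L - d₂)))]
  exact ENNReal.ofReal_le_ofReal (ladderN3_real u m w hx0 hx (hE c₁) (hE' c₁) (hE d₂) (hE' d₂)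
    (hE d₁) (hE (L - d₁)) (hE' (L - d₁)) (hE (L - d₂)) (hE' (L - d₂)) (hE (L - c₂)) (hE' (L - c₂))
    (ladderN3_E_mono hx0 (by omega : d₂ ≤ d₁)) (ladderN3_E_mono hx0 (by omega : L - d₁ ≤ L - d₂)))

end Summit.CriticalPhenomena.SAWScalingLimit.Theorems.BoundaryTP2
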